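import Summits.HodgeConjecture.HodgeConjecture.Theorems.F0P3cStCharTSWeightLocConst      -- ★ p851885 (F0P2-p02 g21) (J6-D): brings ★ (J7) `twist_mul_twist_rev_eq_vanDijkWeight_re_sq`, `isUnit_coe_inv_mul_sub_one_of_isRegularElt`, the CM tokens
import Summits.HodgeConjecture.HodgeConjecture.Theorems.F0P3cStCharTSLevelPackage        -- ★ p851901 (LH6-p03 g5) (J6-M): the MODEL constant's tokens `isUnit_rootA∕B_sub_one`, `map_unit_torusCentralScalar_sub_one`
import Summits.HodgeConjecture.HodgeConjecture.Theorems.F0P3cStCharTSTubeModelTransport   -- ★ p851879 (LH6-p03 g5) (J6-T): `rootScalar_eval_eq`, `model_pins`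
import HarnessLib

/-!
# F0 · P3c · line LH6 «StCharTS» — ROAD «JAC-LOC» brick (T4) «MODULUS TRANSPORT»: the MODEL twist constant of ★ (J6-M)∕(J4b) at the one-place writing `(e s, d_w)` IS the
# CM twist constant of ★ (J7)∕(J6-D) at `(s, d)`, hence the two-sided product is `(Re Δ(s))²` (Harish-Chandra 1970 Lemma 22; Weil BNT I §2: the module is a topological invariant)

Cell `pub/hodgecm-mathlib`, crux H413 = `stmt-HodgeConjecture-24833` (lane `--supports … --as helper`), route HCCMUnconditional; seat LH5-p03 (g7), brick (T4) of the road
«JAC-LOC» (holder LH6-p03 (g5); plan = LH7-p03 (g5) mini-census 2026-09-02T15:45:21Z (M0)(M1)(M3); consumer = LH6-p04 (g6) (J6) FILE 4 «CLOSE», the `↑(D s)` of ★ p851969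
`tubeJacobianLocal_of_uniformPackage`'s `hunif`).  THEOREMS ONLY; sorry-free; no definition ∕ instance ∕ notation ∕ named fact; ★-only imports.  HONEST LABEL: count-neutral
bookkeeping, closes no organ; HC_CM is proved only modulo the 7 printed citations (2 remaining: hLiu418 = `stmt-HodgeConjecture-24832`, h413 = `stmt-HodgeConjecture-24833`) until
rung 0 closes.

THE POINT.  ★ (J6-M) `orbit_and_mass_of_small_level` is proved on the ONE-PLACE MODEL `U(σ_w, Φ₃)(L_w)` and prices the sandwich group `P̃` by the constant
`c(s′, d′) = ‖a′ − 1‖_{L_w} · χ⁻_{σ_w}(b′ − 1)` (`a′ = d′₀⁻¹d′₁`, `b′ = d′₀⁻¹d′₂`; `‖·‖ = distribHaarChar`, `χ⁻ = HeisRing.skewModulus` = the module on the `σ`-skew line), times its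
twin at the Weyl-reflected writing `d′ ∘ rev`.  ★ (J7) `twist_mul_twist_rev_eq_vanDijkWeight_re_sq` evaluates the SAME product on the CM carrier `R = LocalRing L v = ∏_{w′∣v} L_{w′}`
(`σ = conjLocal`) as `(Re Δ(s))²`.  At a non-split `v` there is ONE place `w ∣ v`, evaluation `x ↦ x_w` is a `σ`-EQUIVARIANT isomorphism of topological rings `R ≃ L_w`, and the
module of an automorphism is a topological invariant — so the two constants agree unit by unit (`d′ = d_w := (i ↦ (d i)_w)`, ★ p851879 `rootScalar_eval_eq`).
* §1 (Mathlib-generic) `addEquivAddHaarChar_eq_of_semiconj` — `addEquivAddHaarChar φ = addEquivAddHaarChar ψ` when `e ∘ φ = ψ ∘ e` for a `ContinuousAddEquiv e : A ≃ₜ+ B`;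
  `distribHaarChar_eq_of_semiconj` — the same for `distribHaarChar` (a group element acting on `A` vs one acting on `B`); hence for a RING homeomorphism `f : R ≃+* R′`
  intertwining the involutions: **`distribHaarChar_units_map_eq`**, **`skewModulus_units_map_eq`** (`χ⁻_{σ′}(f l) = χ⁻_σ(l)`).
* §2 (CM, non-split `v`, `c • w = w`) **`distribHaarChar_eval_eq`**, **`skewModulus_eval_eq`**: `‖l_w‖_{L_w} = ‖l‖_R`, `χ⁻_{σ_w}(l_w) = χ⁻_σ(l)` for `l ∈ Rˣ` (the CM side in ★
  (J7)'s `letI := borel R` spelling, the model side for ANY Borel structure on `L_w`, as ★ (J4b)∕(J6-M) bind it).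
* §3 DOCKING: **`model_twist_eq_cm_twist`** (one-sided, arbitrary unit ∕ `σ`-fixedness witnesses on both sides — they are `Prop`s, so ★ (J6-M)'s `(isUnit_rootA_sub_one …).unit` ∕
  `map_unit_torusCentralScalar_sub_one …` and ★ (J7)'s `ha.unit` ∕ `hb.unit` instantiate them by proof irrelevance) and the consumer's shape
  **`model_twist_mul_twist_rev_eq_vanDijkWeight_re_sq`**: for `s ∈ T^{CM}` regular with writing `d`, and ANY model torus elements `s′`, `s′_w` with writings `d_w`, `d_w ∘ rev`
  (★ p851981 `cm_model_writing` supplies them), `c(s′, d_w) · c(s′_w, d_w ∘ rev) = (Re Δ(s))²` in `ℝ≥0` — ★ (J6-M)'s product token for token on the left, LH6-p04's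
  `D s = ⟨(Re Δ(s))², _⟩` on the right.

## References
* [HarishChandra1970] Harish-Chandra, *Harmonic analysis on reductive p-adic groups*, LNM 162 (1970), Lemma 22.
* [WeilBNT1967] A. Weil, *Basic Number Theory* (1967), Ch. I §2 (the module of an automorphism), Ch. II §4 Cor. 3.
* [PlatonovRapinchuk1994] V. Platonov, A. Rapinchuk, *Algebraic Groups and Number Theory* (1994), §5.1 (`G(K ⊗ K_v) = G(K_w)` at a non-split place).
* [Rogawski1990] J. D. Rogawski, *Automorphic Representations of Unitary Groups in Three Variables*, Ann. of Math. Stud. 123 (1990), §12.5 p. 182, §4.9 p. 55.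
-/

set_option autoImplicit false
set_option linter.dupNamespace false

noncomputable section

open MeasureTheory Measure Topology NumberField IsDedekindDomain
open scoped NNReal ENNReal Pointwise MatrixGroups
open Literature.NumberTheory.Automorphic Literature.NumberTheory.Automorphic.UnitaryGroup Literature.NumberTheory.Rogawski1990
open Summit.HodgeConjecture.HodgeConjecture.Cruxes.H413.F0P3cStCharTSTorusUnipotentConj (isUnit_rootA_sub_one isUnit_rootB_sub_one)

namespace Summit.HodgeConjecture.HodgeConjecture.Cruxes.H413.F0P3cStCharTSModulusTransport

/-! ## §1 The module of an automorphism is a topological invariant (Mathlib-generic) -/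

section Generic

variable {A B : Type*} [AddGroup A] [TopologicalSpace A] [MeasurableSpace A] [BorelSpace A] [IsTopologicalAddGroup A] [LocallyCompactSpace A]
  [AddGroup B] [TopologicalSpace B] [MeasurableSpace B] [BorelSpace B] [IsTopologicalAddGroup B] [LocallyCompactSpace B]

/-- **`addEquivAddHaarChar` is invariant under conjugation by an isomorphism of topological groups**: if `e : A ≃ₜ+ B` intertwines `φ : A ≃ₜ+ A` and `ψ : B ≃ₜ+ B`
(`e (φ a) = ψ (e a)`), then `φ` and `ψ` scale Haar measures by the same factor (transport a Haar measure of `B` to `A` and compare on a positive compact set).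
[cite: WeilBNT1967, Ch. I §2] -/
theorem addEquivAddHaarChar_eq_of_semiconj (e : A ≃ₜ+ B) (φ : A ≃ₜ+ A) (ψ : B ≃ₜ+ B) (h : ∀ a, e (φ a) = ψ (e a)) :
    addEquivAddHaarChar φ = addEquivAddHaarChar ψ := by
  set μ : Measure B := addHaar with hμ
  set ν : Measure A := μ.map e.symm with hν
  haveI : ν.IsAddHaarMeasure := e.symm.isAddHaarMeasure_map μ
  haveI : ν.Regular := Regular.map e.symm.toHomeomorph
  have hνS : ∀ S : Set A, ν S = μ (e.symm ⁻¹' S) := fun S => (e.symm.toHomeomorph.toMeasurableEquiv).map_apply S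
  -- a positive compact set in `B` and its preimage under `ψ`
  obtain ⟨k⟩ := (inferInstance : Nonempty (TopologicalSpace.PositiveCompacts B))
  have hk0 : μ (ψ ⁻¹' (k : Set B)) ≠ 0 := by
    obtain ⟨b, hb⟩ := k.interior_nonempty
    have hne : (ψ ⁻¹' interior (k : Set B)).Nonempty :=
      ⟨ψ.symm b, by change ψ (ψ.symm b) ∈ interior (k : Set B); rw [ψ.apply_symm_apply]; exact hb⟩
    have hpos : 0 < μ (ψ ⁻¹' interior (k : Set B)) := (isOpen_interior.preimage ψ.continuous).measure_pos μ hne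
    exact (lt_of_lt_of_le hpos (measure_mono (Set.preimage_mono interior_subset))).ne'
  have hktop : μ (ψ ⁻¹' (k : Set B)) ≠ ∞ := by
    have hc : IsCompact (ψ ⁻¹' (k : Set B)) := (ψ.toHomeomorph.isCompact_preimage (s := (k : Set B))).2 k.isCompact
    exact hc.measure_lt_top.ne
  -- both characters rescale `μ (ψ ⁻¹' k)` to `μ k`
  have h1 : addEquivAddHaarChar ψ • μ (ψ ⁻¹' (k : Set B)) = μ (k : Set B) := addEquivAddHaarChar_smul_preimage μ ψ
  have h2 : addEquivAddHaarChar φ • μ (ψ ⁻¹' (k : Set B)) = μ (k : Set B) := by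
    have h2' := addEquivAddHaarChar_smul_preimage ν (X := e ⁻¹' (k : Set B)) φ
    have e1 : e.symm ⁻¹' (φ ⁻¹' (e ⁻¹' (k : Set B))) = ψ ⁻¹' (k : Set B) := by
      ext b
      simp only [Set.mem_preimage]
      rw [h, e.apply_symm_apply]
    have e2 : e.symm ⁻¹' (e ⁻¹' (k : Set B)) = (k : Set B) := by
      ext b
      simp only [Set.mem_preimage, e.apply_symm_apply]
    rwa [hνS, hνS, e1, e2] at h2'
  rw [← h2, ENNReal.smul_def, ENNReal.smul_def, smul_eq_mul, smul_eq_mul] at h1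
  have := (ENNReal.mul_left_inj hk0 hktop).1 h1
  exact_mod_cast this.symm

end Generic

section GenericDistrib

variable {G H A B : Type*} [Group G] [Group H]
  [AddCommGroup A] [DistribMulAction G A] [TopologicalSpace A] [IsTopologicalAddGroup A] [LocallyCompactSpace A] [ContinuousConstSMul G A]
  [AddCommGroup B] [DistribMulAction H B] [TopologicalSpace B] [IsTopologicalAddGroup B] [LocallyCompactSpace B] [ContinuousConstSMul H B]

/-- **Transport of the distributive Haar character** along an equivariant isomorphism `e : A ≃ₜ+ B` (`e (g • a) = h • e a`): `Δ_A(g) = Δ_B(h)` (same argument as ★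
`Literature.NumberTheory.Automorphic.distribHaarChar_eq_of_continuousAddEquiv`, re-proved here to keep the import cone inside the road). [cite: WeilBNT1967, Ch. I §2] -/
theorem distribHaarChar_eq_of_semiconj (e : A ≃ₜ+ B) (g : G) (h : H) (he : ∀ a, e (g • a) = h • e a) :
    distribHaarChar A g = distribHaarChar B h := by
  borelize A B
  set μ : Measure B := addHaar with hμ
  set ν : Measure A := μ.map e.symm with hν
  haveI : ν.IsAddHaarMeasure := e.symm.isAddHaarMeasure_map μ
  haveI : ν.Regular := Regular.map e.symm.toHomeomorph
  have hνS : ∀ S : Set A, ν S = μ (e.symm ⁻¹' S) := fun S => (e.symm.toHomeomorph.toMeasurableEquiv).map_apply S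
  have he' : ∀ a, e (g⁻¹ • a) = h⁻¹ • e a := fun a => by rw [eq_inv_smul_iff, ← he, smul_inv_smul]
  obtain ⟨k⟩ := (inferInstance : Nonempty (TopologicalSpace.PositiveCompacts B))
  have hk0 : μ (k : Set B) ≠ 0 := (Measure.measure_pos_of_nonempty_interior _ k.interior_nonempty).ne'
  have hktop : μ (k : Set B) ≠ ∞ := k.isCompact.measure_lt_top.ne
  have h1 : e.symm ⁻¹' (e ⁻¹' (k : Set B)) = k := by ext b; simp only [Set.mem_preimage, ContinuousAddEquiv.apply_symm_apply]
  have h2 : e.symm ⁻¹' (g • (e ⁻¹' (k : Set B))) = h • (k : Set B) := by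
    ext b; simp only [Set.mem_preimage, Set.mem_smul_set_iff_inv_smul_mem, he', ContinuousAddEquiv.apply_symm_apply]
  refine distribHaarChar_eq_of_measure_smul_eq_mul (μ := ν) (s := e ⁻¹' (k : Set B)) (by rw [hνS, h1]; exact hk0) (by rw [hνS, h1]; exact hktop) ?_
  rw [hνS, hνS, h1, h2, distribHaarChar_mul]

end GenericDistrib

section Ring

variable {R R' : Type*} [CommRing R] [TopologicalSpace R] [IsTopologicalRing R] [LocallyCompactSpace R] [T2Space R] [MeasurableSpace R] [BorelSpace R]
  [CommRing R'] [TopologicalSpace R'] [IsTopologicalRing R'] [LocallyCompactSpace R'] [T2Space R'] [MeasurableSpace R'] [BorelSpace R']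

omit [T2Space R] [MeasurableSpace R] [BorelSpace R] [T2Space R'] [MeasurableSpace R'] [BorelSpace R'] in
/-- **`‖f l‖_{R′} = ‖l‖_R`** for an isomorphism of topological rings `f : R ≃+* R′` (continuous both ways) and a unit `l`. [cite: WeilBNT1967, Ch. I §2] -/
theorem distribHaarChar_units_map_eq (f : R ≃+* R') (hf : Continuous f) (hf' : Continuous f.symm) (l : Rˣ) :
    distribHaarChar R' (Units.map f.toMonoidHom l) = distribHaarChar R l := by
  let e : R ≃ₜ+ R' := { f.toAddEquiv with continuous_toFun := hf, continuous_invFun := hf' }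
  refine (distribHaarChar_eq_of_semiconj e l (Units.map f.toMonoidHom l) fun a => ?_).symm
  change f ((l : R) • a) = ((Units.map f.toMonoidHom l : R'ˣ) : R') • f a
  rw [smul_eq_mul, smul_eq_mul, map_mul, Units.coe_map]
  rfl

/-- **`χ⁻_{σ′}(f l) = χ⁻_σ(l)`**: the module of a `σ`-fixed unit on the `σ`-skew line is invariant under an isomorphism of topological rings `f : R ≃+* R′` INTERTWINING the
involutions (`f ∘ σ = σ′ ∘ f`): `f` restricts to `R⁻_σ ≃ₜ+ R′⁻_{σ′}` and intertwines the two scalings. [cite: WeilBNT1967, Ch. I §2] [cite: Rogawski1990, §1.10 p. 9] -/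
theorem skewModulus_units_map_eq (σ : R →+* R) (hσc : Continuous σ) (σ' : R' →+* R') (hσ'c : Continuous σ')
    (f : R ≃+* R') (hf : Continuous f) (hf' : Continuous f.symm) (hfσ : ∀ x, f (σ x) = σ' (f x))
    (l : Rˣ) (hl : σ (l : R) = l) (hl' : σ' ((Units.map f.toMonoidHom l : R'ˣ) : R') = (Units.map f.toMonoidHom l : R'ˣ)) :
    HeisRing.skewModulus σ' hσ'c (Units.map f.toMonoidHom l) hl' = HeisRing.skewModulus σ hσc l hl := by
  haveI := HeisRing.locallyCompactSpace_skewPart σ hσc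
  haveI := HeisRing.locallyCompactSpace_skewPart σ' hσ'c
  have hfσ' : ∀ y, f.symm (σ' y) = σ (f.symm y) := fun y => by
    apply f.injective; rw [hfσ, f.apply_symm_apply, f.apply_symm_apply]
  -- `f` restricted to the skew lines
  have hmem : ∀ x : HeisRing.skewPart σ, f (x : R) ∈ HeisRing.skewPart σ' := fun x => by
    rw [HeisRing.mem_skewPart_iff, ← hfσ, (HeisRing.mem_skewPart_iff σ _).1 x.2, map_neg]
  have hmem' : ∀ y : HeisRing.skewPart σ', f.symm (y : R') ∈ HeisRing.skewPart σ := fun y => by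
    rw [HeisRing.mem_skewPart_iff, ← hfσ', (HeisRing.mem_skewPart_iff σ' _).1 y.2, map_neg]
  let eS : HeisRing.skewPart σ ≃ₜ+ HeisRing.skewPart σ' :=
    { toFun := fun x => ⟨f x, hmem x⟩
      invFun := fun y => ⟨f.symm y, hmem' y⟩
      left_inv := fun x => Subtype.ext (f.symm_apply_apply _)
      right_inv := fun y => Subtype.ext (f.apply_symm_apply _)
      map_add' := fun x y => Subtype.ext (by simp only [AddSubgroup.coe_add, map_add])
      continuous_toFun := (hf.comp continuous_subtype_val).subtype_mk hmem
      continuous_invFun := (hf'.comp continuous_subtype_val).subtype_mk hmem' }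
  symm
  refine addEquivAddHaarChar_eq_of_semiconj eS (HeisRing.smulSkew σ l hl) (HeisRing.smulSkew σ' (Units.map f.toMonoidHom l) hl') fun x => Subtype.ext ?_
  change f ((l : R) * x) = ((Units.map f.toMonoidHom l : R'ˣ) : R') * f x
  rw [map_mul, Units.coe_map]
  rfl

omit [TopologicalSpace R] [IsTopologicalRing R] [LocallyCompactSpace R] [T2Space R] [MeasurableSpace R] [BorelSpace R] in
/-- `χ⁻_σ` does not see WHICH unit term names the scalar: `l = l′ ⇒ χ⁻(l) = χ⁻(l′)` (the `σ`-fixedness witnesses are propositions). [cite: Rogawski1990, §1.10 p. 9] -/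
theorem skewModulus_congr_units {S : Type*} [CommRing S] [TopologicalSpace S] [IsTopologicalRing S] [LocallyCompactSpace S] [T2Space S] [MeasurableSpace S] [BorelSpace S]
    (σ : S →+* S) (hσc : Continuous σ) {l l' : Sˣ} (h : l = l') (hl : σ (l : S) = l) (hl' : σ (l' : S) = l') :
    HeisRing.skewModulus σ hσc l hl = HeisRing.skewModulus σ hσc l' hl' := by
  subst h; rfl

end Ring

/-! ## §2 The CM instance: `R = LocalRing L v ≃ L_w` at a non-split place -/

section CM

variable (L : Type) [Field L] [NumberField L] [IsCMField L] (v : HeightOneSpectrum (𝓞 ↥(maximalRealSubfield L)))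
  (w : PlacesOver L v) (hw : IsCMField.complexConj L • w.1 = w.1)

include hw in
/-- `(σ x)_w = σ_w (x_w)`: `conjLocal` at the unique place above a non-split `v` is the Galois transport on that factor (private copy of ★ `conjLocal_apply_of_smul_eq'`).
[cite: PlatonovRapinchuk1994, §5.1] -/
private theorem conjLocal_apply_of_smul_eq_mt (x : LocalRing L v) :
    conjLocal L (IsCMField.complexConj L) v x w = galAdicCompletionMap (L := L) (IsCMField.complexConj L) hw (x w) := by
  have key : ∀ (w₁ : PlacesOver L v) (h₁ : IsCMField.complexConj L • w₁.1 = w.1),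
      galAdicCompletionMap (L := L) (IsCMField.complexConj L) h₁ (x w₁) = galAdicCompletionMap (L := L) (IsCMField.complexConj L) hw (x w) := by
    intro w₁ h₁
    have e : w₁ = w := PlacesOver.eq_of_smul_eq (IsCMField.complexConj L) (IsCMField.complexConj_ne_one L) w hw w₁
    subst e
    rfl
  rw [conjLocal_apply]
  exact key ⟨(IsCMField.complexConj L)⁻¹ • w.1, under_inv_smul_eq (IsCMField.complexConj L) w⟩ (smul_inv_smul (IsCMField.complexConj L) w.1)

include hw in
/-- **`‖l_w‖_{L_w} = ‖l‖_{L ⊗ L⁺_v}`** at a non-split `v` (`l_w = Units.map (eval_w) l`): evaluation at the unique place `w ∣ v` is an isomorphism of topological rings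
`∏_{w′∣v} L_{w′} ≃ L_w` (Mathlib `RingEquiv.piUnique` ∕ `Homeomorph.piUnique`), and the module is a topological invariant (§1). [cite: WeilBNT1967, Ch. I §2] [cite: PlatonovRapinchuk1994, §5.1] -/
theorem distribHaarChar_eval_eq (l : (LocalRing L v)ˣ) :
    distribHaarChar (w.1.adicCompletion L) (Units.map (Pi.evalRingHom (fun w' : PlacesOver L v => w'.1.adicCompletion L) w).toMonoidHom l) =
      distribHaarChar (LocalRing L v) l := by
  letI : Unique (PlacesOver L v) := @uniqueOfSubsingleton _ (PlacesOver.subsingleton_of_smul_eq (IsCMField.complexConj L) (IsCMField.complexConj_ne_one L) w hw) w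
  let f : LocalRing L v ≃+* w.1.adicCompletion L := RingEquiv.piUnique (fun w' : PlacesOver L v => w'.1.adicCompletion L)
  have hf : Continuous f := continuous_apply w
  have hf' : Continuous f.symm := (Homeomorph.piUnique (fun w' : PlacesOver L v => w'.1.adicCompletion L)).symm.continuous
  have hfe : (f.toMonoidHom : LocalRing L v →* w.1.adicCompletion L) = (Pi.evalRingHom (fun w' : PlacesOver L v => w'.1.adicCompletion L) w).toMonoidHom := by
    ext x; rfl
  rw [← hfe]
  exact distribHaarChar_units_map_eq f hf hf' l

include hw in
/-- **`χ⁻_{σ_w}(l_w) = χ⁻_σ(l)`** at a non-split `v` for a `σ`-fixed unit `l` of `L ⊗ L⁺_v` (`σ = conjLocal`, `σ_w = galAdicCompletionMap`): the CM side in ★ (J7)'s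
`letI := borel (LocalRing L v)` spelling, the model side for ANY Borel structure on `L_w` (as ★ (J4b)∕(J6-M) bind it). [cite: WeilBNT1967, Ch. I §2] [cite: PlatonovRapinchuk1994, §5.1]
[cite: Rogawski1990, §1.10 p. 9] -/
theorem skewModulus_eval_eq [MeasurableSpace (w.1.adicCompletion L)] [BorelSpace (w.1.adicCompletion L)]
    (l : (LocalRing L v)ˣ) (hl : conjLocal L (IsCMField.complexConj L) v (l : LocalRing L v) = l)
    (hl' : galAdicCompletionMap (L := L) (IsCMField.complexConj L) hw
        ((Units.map (Pi.evalRingHom (fun w' : PlacesOver L v => w'.1.adicCompletion L) w).toMonoidHom l : (w.1.adicCompletion L)ˣ) : w.1.adicCompletion L) =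
      (Units.map (Pi.evalRingHom (fun w' : PlacesOver L v => w'.1.adicCompletion L) w).toMonoidHom l : (w.1.adicCompletion L)ˣ)) :
    HeisRing.skewModulus (galAdicCompletionMap (L := L) (IsCMField.complexConj L) hw) (continuous_galAdicCompletionMap L (IsCMField.complexConj L) hw)
        (Units.map (Pi.evalRingHom (fun w' : PlacesOver L v => w'.1.adicCompletion L) w).toMonoidHom l) hl' =
      (letI : MeasurableSpace (LocalRing L v) := borel _; haveI : BorelSpace (LocalRing L v) := ⟨rfl⟩
        HeisRing.skewModulus (conjLocal L (IsCMField.complexConj L) v) (continuous_conjLocal L (IsCMField.complexConj L) v) l hl) := by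
  letI : MeasurableSpace (LocalRing L v) := borel _
  haveI : BorelSpace (LocalRing L v) := ⟨rfl⟩
  letI : Unique (PlacesOver L v) := @uniqueOfSubsingleton _ (PlacesOver.subsingleton_of_smul_eq (IsCMField.complexConj L) (IsCMField.complexConj_ne_one L) w hw) w
  let f : LocalRing L v ≃+* w.1.adicCompletion L := RingEquiv.piUnique (fun w' : PlacesOver L v => w'.1.adicCompletion L)
  have hf : Continuous f := continuous_apply w
  have hf' : Continuous f.symm := (Homeomorph.piUnique (fun w' : PlacesOver L v => w'.1.adicCompletion L)).symm.continuous
  have hfσ : ∀ x, f (conjLocal L (IsCMField.complexConj L) v x) = galAdicCompletionMap (L := L) (IsCMField.complexConj L) hw (f x) :=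
    fun x => conjLocal_apply_of_smul_eq_mt L v w hw x
  have hfe : Units.map f.toMonoidHom l = Units.map (Pi.evalRingHom (fun w' : PlacesOver L v => w'.1.adicCompletion L) w).toMonoidHom l := by
    ext; rfl
  have hlf : galAdicCompletionMap (L := L) (IsCMField.complexConj L) hw ((Units.map f.toMonoidHom l : (w.1.adicCompletion L)ˣ) : w.1.adicCompletion L) =
      (Units.map f.toMonoidHom l : (w.1.adicCompletion L)ˣ) := by rw [hfe]; exact hl'
  rw [← skewModulus_units_map_eq (conjLocal L (IsCMField.complexConj L) v) (continuous_conjLocal L (IsCMField.complexConj L) v)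
    (galAdicCompletionMap (L := L) (IsCMField.complexConj L) hw) (continuous_galAdicCompletionMap L (IsCMField.complexConj L) hw) f hf hf' hfσ l hl hlf]
  exact skewModulus_congr_units _ _ hfe.symm _ _

end CM

/-! ## §3 Docking: the MODEL constant of ★ (J6-M)∕(J4b) at `(e s, d_w)` is the CM constant of ★ (J7)∕(J6-D) at `(s, d)` -/

section Dock

variable (L : Type) [Field L] [NumberField L] [IsCMField L] (v : HeightOneSpectrum (𝓞 ↥(maximalRealSubfield L)))
  (w : PlacesOver L v) (hw : IsCMField.complexConj L • w.1 = w.1)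

include hw in
/-- **ONE-SIDED DOCKING.**  For a diagonal writing `d : Fin 3 → Rˣ` on the CM carrier `R = L ⊗ L⁺_v` and its one-place reading `d_w i = (d i)_w` (`hdw`), the MODEL one-sided twist
constant `‖a_w − 1‖_{L_w} · χ⁻_{σ_w}(b_w − 1)` (`a_w = d_w₀⁻¹d_w₁`, `b_w = d_w₀⁻¹d_w₂`; ★ (J4b)∕(J6-M)'s tokens, ANY Borel structure on `L_w`) equals the CM one-sided constant
`‖a − 1‖_R · χ⁻_σ(b − 1)` (★ (J7)∕(J6-D)'s tokens, `letI := borel R`).  The unit ∕ `σ`-fixedness witnesses on both sides are ARBITRARY (propositions): ★ (J6-M)'s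
`(isUnit_rootA_sub_one …).unit`, `map_unit_torusCentralScalar_sub_one …` and ★ (J7)'s `ha.unit`, `hb.unit` instantiate them by proof irrelevance.  (★ `rootScalar_eval_eq`: `a_w − 1 =
(a − 1)_w`; then §2.) [cite: HarishChandra1970, Lemma 22] [cite: WeilBNT1967, Ch. I §2] [cite: PlatonovRapinchuk1994, §5.1] -/
theorem model_twist_eq_cm_twist [MeasurableSpace (w.1.adicCompletion L)] [BorelSpace (w.1.adicCompletion L)]
    (d : Fin 3 → (LocalRing L v)ˣ) (dw : Fin 3 → (w.1.adicCompletion L)ˣ)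
    (hdw : ∀ i, dw i = Units.map (Pi.evalRingHom (fun w' : PlacesOver L v => w'.1.adicCompletion L) w).toMonoidHom (d i))
    (ha' : IsUnit ((((dw 0)⁻¹ * dw 1 : (w.1.adicCompletion L)ˣ) : w.1.adicCompletion L) - 1))
    (hb' : IsUnit ((((dw 0)⁻¹ * dw 2 : (w.1.adicCompletion L)ˣ) : w.1.adicCompletion L) - 1))
    (hσb' : galAdicCompletionMap (L := L) (IsCMField.complexConj L) hw ((hb'.unit : (w.1.adicCompletion L)ˣ) : w.1.adicCompletion L) = hb'.unit)
    (ha : IsUnit ((((d 0)⁻¹ * d 1 : (LocalRing L v)ˣ) : LocalRing L v) - 1))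
    (hb : IsUnit ((((d 0)⁻¹ * d 2 : (LocalRing L v)ˣ) : LocalRing L v) - 1))
    (hσb : conjLocal L (IsCMField.complexConj L) v ((hb.unit : (LocalRing L v)ˣ) : LocalRing L v) = hb.unit) :
    distribHaarChar (w.1.adicCompletion L) ha'.unit *
        HeisRing.skewModulus (galAdicCompletionMap (L := L) (IsCMField.complexConj L) hw) (continuous_galAdicCompletionMap L (IsCMField.complexConj L) hw) hb'.unit hσb' =
      (letI : MeasurableSpace (LocalRing L v) := borel _; haveI : BorelSpace (LocalRing L v) := ⟨rfl⟩
        distribHaarChar (LocalRing L v) ha.unit *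
          HeisRing.skewModulus (conjLocal L (IsCMField.complexConj L) v) (continuous_conjLocal L (IsCMField.complexConj L) v) hb.unit hσb) := by
  letI : MeasurableSpace (LocalRing L v) := borel _
  haveI : BorelSpace (LocalRing L v) := ⟨rfl⟩
  -- the two unit terms are the one-place readings of the CM unit terms (★ `rootScalar_eval_eq`)
  have hau : ha'.unit = Units.map (Pi.evalRingHom (fun w' : PlacesOver L v => w'.1.adicCompletion L) w).toMonoidHom ha.unit := by
    apply Units.ext
    rw [IsUnit.unit_spec, Units.coe_map, IsUnit.unit_spec, hdw, hdw]
    exact F0P3cStCharTSTubeModelTransport.rootScalar_eval_eq L v w d 0 1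
  have hbu : hb'.unit = Units.map (Pi.evalRingHom (fun w' : PlacesOver L v => w'.1.adicCompletion L) w).toMonoidHom hb.unit := by
    apply Units.ext
    rw [IsUnit.unit_spec, Units.coe_map, IsUnit.unit_spec, hdw, hdw]
    exact F0P3cStCharTSTubeModelTransport.rootScalar_eval_eq L v w d 0 2
  have hσbu : galAdicCompletionMap (L := L) (IsCMField.complexConj L) hw
      ((Units.map (Pi.evalRingHom (fun w' : PlacesOver L v => w'.1.adicCompletion L) w).toMonoidHom hb.unit : (w.1.adicCompletion L)ˣ) : w.1.adicCompletion L) =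
        (Units.map (Pi.evalRingHom (fun w' : PlacesOver L v => w'.1.adicCompletion L) w).toMonoidHom hb.unit : (w.1.adicCompletion L)ˣ) := by
    rw [← hbu]; exact hσb'
  rw [skewModulus_congr_units _ _ hbu hσb' hσbu, hau, distribHaarChar_eval_eq L v w hw, skewModulus_eval_eq L v w hw hb.unit hσb hσbu]

include hw in
/-- **(T4) TWO-SIDED DOCKING — the consumer's shape** (LH6-p04 (g6) (J6) FILE 4 «CLOSE»: the `↑(D s)` of ★ p851969 `tubeJacobianLocal_of_uniformPackage`'s `hunif` with
`D s = ⟨(Re Δ(s))², _⟩`).  For `s` in the CM split torus with writing `d` (regular: the four root scalars minus one are units, ★ (J6-D) §1), and ANY model torus elements `s′`, `s′_w` of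
`U(σ_w, Φ₃)(L_w)` with writings `d_w`, `d_w ∘ rev` (★ p851981 `cm_model_writing` supplies `(e s, sw)`), ★ (J6-M) `orbit_and_mass_of_small_level`'s product of twist constants
— its conclusion's scalar, TOKEN FOR TOKEN at `(σ, hσc, hJ) := (σ_w, continuous_galAdicCompletionMap …, (model_pins …).2.2.2)` (any other proofs of these propositions give the same
term) — equals `(Re Δ(s))²` as an element of `ℝ≥0`: the two factors are the CM one-sided constants at `d` and `d ∘ rev` (`model_twist_eq_cm_twist`), whose product ★ (J7)
`twist_mul_twist_rev_eq_vanDijkWeight_re_sq` evaluates.  `w₀` is a CM unitary with `↑↑w₀ = Φ₃` (★ (J7)'s binder; it only names the Weyl reflection inside (J7)'s proof).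
[cite: HarishChandra1970, Lemma 22] [cite: Rogawski1990, §12.5 p. 182; §4.9 p. 55] [cite: PlatonovRapinchuk1994, §5.1] -/
theorem model_twist_mul_twist_rev_eq_vanDijkWeight_re_sq (hns : ∀ w' : PlacesOver L v, IsCMField.complexConj L • w'.1 = w'.1)
    [MeasurableSpace (w.1.adicCompletion L)] [BorelSpace (w.1.adicCompletion L)]
    (w₀ : ↥(unitaryGroupOfForm (conjLocal L (IsCMField.complexConj L) v) (cmLocalForm L 3 v))) (hw₀ : Units.val (w₀ : GL (Fin 3) (LocalRing L v)) = cmLocalForm L 3 v)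
    (s : ↥(cmBorelTriple L 3 v).M)
    (hreg : IsRegularElt (((s : ↥(unitaryGroupOfForm (conjLocal L (IsCMField.complexConj L) v) (cmLocalForm L 3 v))) : GL (Fin 3) (LocalRing L v))))
    {d : Fin 3 → (LocalRing L v)ˣ}
    (hd : glDiagonal 3 (LocalRing L v) d = ((s : ↥(unitaryGroupOfForm (conjLocal L (IsCMField.complexConj L) v) (cmLocalForm L 3 v))) : GL (Fin 3) (LocalRing L v)))
    (dw : Fin 3 → (w.1.adicCompletion L)ˣ)
    (hdw : ∀ i, dw i = Units.map (Pi.evalRingHom (fun w' : PlacesOver L v => w'.1.adicCompletion L) w).toMonoidHom (d i))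
    (s' sw' : ↥(torusU (galAdicCompletionMap (L := L) (IsCMField.complexConj L) hw) (placeForm (Literature.NumberTheory.Rogawski1990.qsForm L) w.1)))
    (hd' : glDiagonal 3 (w.1.adicCompletion L) dw =
      ((s' : ↥(unitaryGroupOfForm (galAdicCompletionMap (L := L) (IsCMField.complexConj L) hw) (placeForm (Literature.NumberTheory.Rogawski1990.qsForm L) w.1))) : GL (Fin 3) (w.1.adicCompletion L)))
    (hdw' : glDiagonal 3 (w.1.adicCompletion L) (dw ∘ Fin.rev) =
      ((sw' : ↥(unitaryGroupOfForm (galAdicCompletionMap (L := L) (IsCMField.complexConj L) hw) (placeForm (Literature.NumberTheory.Rogawski1990.qsForm L) w.1))) : GL (Fin 3) (w.1.adicCompletion L)))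
    (hreg' : IsRegularElt ((s' : ↥(unitaryGroupOfForm (galAdicCompletionMap (L := L) (IsCMField.complexConj L) hw) (placeForm (Literature.NumberTheory.Rogawski1990.qsForm L) w.1))) : GL (Fin 3) (w.1.adicCompletion L)))
    (hregw' : IsRegularElt ((sw' : ↥(unitaryGroupOfForm (galAdicCompletionMap (L := L) (IsCMField.complexConj L) hw) (placeForm (Literature.NumberTheory.Rogawski1990.qsForm L) w.1))) : GL (Fin 3) (w.1.adicCompletion L))) :
    distribHaarChar (w.1.adicCompletion L)
          (isUnit_rootA_sub_one (galAdicCompletionMap (L := L) (IsCMField.complexConj L) hw) s' hd' hreg').unit *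
        HeisRing.skewModulus (galAdicCompletionMap (L := L) (IsCMField.complexConj L) hw) (continuous_galAdicCompletionMap L (IsCMField.complexConj L) hw)
          (isUnit_rootB_sub_one (galAdicCompletionMap (L := L) (IsCMField.complexConj L) hw) s' hd' hreg').unit
          (HeisRing.map_unit_torusCentralScalar_sub_one (galAdicCompletionMap (L := L) (IsCMField.complexConj L) hw)
            (F0P3cStCharTSTubeModelTransport.model_pins L v w hw).2.2.2 s' hd'
            (isUnit_rootB_sub_one (galAdicCompletionMap (L := L) (IsCMField.complexConj L) hw) s' hd' hreg')) *
      (distribHaarChar (w.1.adicCompletion L)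
          (isUnit_rootA_sub_one (galAdicCompletionMap (L := L) (IsCMField.complexConj L) hw) sw' hdw' hregw').unit *
        HeisRing.skewModulus (galAdicCompletionMap (L := L) (IsCMField.complexConj L) hw) (continuous_galAdicCompletionMap L (IsCMField.complexConj L) hw)
          (isUnit_rootB_sub_one (galAdicCompletionMap (L := L) (IsCMField.complexConj L) hw) sw' hdw' hregw').unit
          (HeisRing.map_unit_torusCentralScalar_sub_one (galAdicCompletionMap (L := L) (IsCMField.complexConj L) hw)
            (F0P3cStCharTSTubeModelTransport.model_pins L v w hw).2.2.2 sw' hdw'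
            (isUnit_rootB_sub_one (galAdicCompletionMap (L := L) (IsCMField.complexConj L) hw) sw' hdw' hregw'))) =
      ⟨(F0P3cStCharTSTorusDefs.vanDijkWeight L v s).re ^ 2, sq_nonneg _⟩ := by
  -- the four CM root units of the regular `s = diag(d)`
  have hregd : IsRegularElt (glDiagonal 3 (LocalRing L v) d) := by rw [hd]; exact hreg
  have ha : IsUnit ((((d 0)⁻¹ * d 1 : (LocalRing L v)ˣ) : LocalRing L v) - 1) :=
    F0P3cStCharTSWeightLocConst.isUnit_coe_inv_mul_sub_one_of_isRegularElt hregd (by decide)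
  have hb : IsUnit ((((d 0)⁻¹ * d 2 : (LocalRing L v)ˣ) : LocalRing L v) - 1) :=
    F0P3cStCharTSWeightLocConst.isUnit_coe_inv_mul_sub_one_of_isRegularElt hregd (by decide)
  have ha₂ : IsUnit ((((d 2)⁻¹ * d 1 : (LocalRing L v)ˣ) : LocalRing L v) - 1) :=
    F0P3cStCharTSWeightLocConst.isUnit_coe_inv_mul_sub_one_of_isRegularElt hregd (by decide)
  have hb₂ : IsUnit ((((d 2)⁻¹ * d 0 : (LocalRing L v)ˣ) : LocalRing L v) - 1) :=
    F0P3cStCharTSWeightLocConst.isUnit_coe_inv_mul_sub_one_of_isRegularElt hregd (by decide)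
  -- their `σ`-fixedness (★ HeisRing, on the CM torus and on its Weyl reflection)
  have hσb := HeisRing.map_unit_torusCentralScalar_sub_one (conjLocal L (IsCMField.complexConj L) v) (cmLocalForm_eq_over L 3 v) s hd hb
  have hσb₂ := HeisRing.map_unit_torusCentralScalar_sub_one (conjLocal L (IsCMField.complexConj L) v) (cmLocalForm_eq_over L 3 v)
    (⟨w₀ * (s : ↥(unitaryGroupOfForm (conjLocal L (IsCMField.complexConj L) v) (cmLocalForm L 3 v))) * w₀⁻¹,
      weylConj_mem_torusU (conjLocal L (IsCMField.complexConj L) v) (cmLocalForm_eq_over L 3 v) w₀ hw₀ s⟩ :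
        ↥(torusU (conjLocal L (IsCMField.complexConj L) v) (cmLocalForm L 3 v)))
    (glDiagonal_rev_eq_weylConj (conjLocal L (IsCMField.complexConj L) v) (cmLocalForm_eq_over L 3 v) w₀ hw₀ s hd) hb₂
  -- dock each factor on the CM side
  have h1 := model_twist_eq_cm_twist L v w hw d dw hdw
    (isUnit_rootA_sub_one (galAdicCompletionMap (L := L) (IsCMField.complexConj L) hw) s' hd' hreg')
    (isUnit_rootB_sub_one (galAdicCompletionMap (L := L) (IsCMField.complexConj L) hw) s' hd' hreg')
    (HeisRing.map_unit_torusCentralScalar_sub_one (galAdicCompletionMap (L := L) (IsCMField.complexConj L) hw)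
      (F0P3cStCharTSTubeModelTransport.model_pins L v w hw).2.2.2 s' hd'
      (isUnit_rootB_sub_one (galAdicCompletionMap (L := L) (IsCMField.complexConj L) hw) s' hd' hreg')) ha hb hσb
  have h2 := model_twist_eq_cm_twist L v w hw (d ∘ Fin.rev) (dw ∘ Fin.rev) (fun i => hdw (Fin.rev i))
    (isUnit_rootA_sub_one (galAdicCompletionMap (L := L) (IsCMField.complexConj L) hw) sw' hdw' hregw')
    (isUnit_rootB_sub_one (galAdicCompletionMap (L := L) (IsCMField.complexConj L) hw) sw' hdw' hregw')
    (HeisRing.map_unit_torusCentralScalar_sub_one (galAdicCompletionMap (L := L) (IsCMField.complexConj L) hw)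
      (F0P3cStCharTSTubeModelTransport.model_pins L v w hw).2.2.2 sw' hdw'
      (isUnit_rootB_sub_one (galAdicCompletionMap (L := L) (IsCMField.complexConj L) hw) sw' hdw' hregw')) ha₂ hb₂ hσb₂
  rw [h1, h2]
  apply NNReal.eq
  exact F0P3cStCharTSWeylHypWeightId.twist_mul_twist_rev_eq_vanDijkWeight_re_sq L v w₀ hw₀ hns s d hd ha hb ha₂ hb₂

end Dock

end Summit.HodgeConjecture.HodgeConjecture.Cruxes.H413.F0P3cStCharTSModulusTransport

end
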